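import Literature.IUT.HodgeTheaters.ThetaNFHodgeTheaters
import Literature.IUT.HodgeTheaters.FrobenioidBridgeModelsProofs
import HarnessLib

/-!
# Proofs for ΘNF-Hodge theaters: non-vacuity of Definition 5.5 and Corollary 5.6 (iii) ([IUTchI] pp. 151–154) —
# abc-iut cell, layer L5 (discharge of `ThetaNFHodgeTheaters.lean`)

Mochizuki, *Inter-universal Teichmüller theory I*, §5 (kurims May-2020 manuscript). Over ANY stub `S : S5Local 𝔡`:
* `nonempty_nFBridge`, `nonempty_thetaNFHodgeTheater`, `nonempty_thetaBridge`: Definition 5.5 (i)–(iii) is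
  NON-VACUOUS — the model capsule, the model
  `ℱ^⊚ ⇢ ℱ^⊛`, `‡ψ^NF_j := δ₀(j⁻¹·[ε])`, the model Θ-Hodge theater `S.HT` and the transported model `𝒟`-Θ-bridge
  form a ΘNF-Hodge theater (L5 KIT RULE: the model types fed by the stub are inhabited);
* `cor56iii_holds`: Corollary 5.6 (iii) ("the set of capsule-full poly-isomorphisms … which allow one to glue the
  given NF- and Θ-bridges together … forms an `F_l^⋇`-torsor"; by the printed proof "[cf. also Proposition 4.8,
  (iii)]" the gluings are those of the underlying base-bridges) follows from `prop48iii_holds`.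
Proof-only companion; record-only, [claim: Mochizuki2012, status: disputed]; nothing here takes a side.
-/

namespace Literature.IUT.HodgeTheaters

open CategoryTheory

universe u

namespace BaseThetaDatum

namespace S5Local

variable {𝔡 : BaseThetaDatum.{u}} (S : S5Local 𝔡)

/-- **Definition 5.5 (i) is non-vacuous over every stub** (L5 KIT RULE; Ex. 5.4 (v): "there exists a unique
poly-morphism `†ψ^NF_⋆ : †ℱ_J → †ℱ^⊚` that lies over `†φ^NF_⋆`"): the capsule of copies of the model `ℱ`-prime-strip
indexed by `F_l^⋇`, the model `ℱ^⊚ ⇢ ℱ^⊛`, and `‡ψ^NF_j := δ₀(j⁻¹·[ε])` for any `δ₀ : 𝒟^⊚ ⥲` (base of `ℱ^⊚`) form an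
NF-bridge (`FPolyHomNF.under_eq_conj`). [claim: Mochizuki2012, status: disputed] -/
theorem nonempty_nFBridge : Nonempty (NFBridge S) := by
  obtain ⟨δ₀⟩ := 𝔡.nonempty_isoG 𝔡.DG (S.baseG S.FG)
  obtain ⟨κ₀⟩ := DPrimeStrip.nonempty_iso 𝔡.tautStrip (FPrimeStrip.base (S := S) fun v => S.F v)
  exact ⟨{ J := FlStar 𝔡.l, capsuleF := fun _ v => S.F v, globF := S.FG, globFF := S.FGlob, dash := S.dashModel,
           psiNF := fun j => 𝔡.labIsoG δ₀ (j⁻¹ • 𝔡.εLab),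
           under_isModel := ⟨Equiv.refl _, fun _ => κ₀, δ₀, fun j v => by
             rw [Equiv.refl_apply, FPolyHomNF.under_eq_conj S δ₀ j⁻¹ v (Pi.isoApp κ₀ v), inv_inv]⟩ }⟩

/-- **Definition 5.5 (iii) is non-vacuous over every stub**: a ΘNF-Hodge theater built from the model data — the
NF-bridge of `nonempty_nFBridge` together with the model Θ-Hodge theater `S.HT` and the model `𝒟`-Θ-bridge
transported to the bases. [claim: Mochizuki2012, status: disputed] -/
theorem nonempty_thetaNFHodgeTheater : Nonempty (ThetaNFHodgeTheater S) := by
  obtain ⟨δ₀⟩ := 𝔡.nonempty_isoG 𝔡.DG (S.baseG S.FG)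
  obtain ⟨κ₀⟩ := DPrimeStrip.nonempty_iso 𝔡.tautStrip (FPrimeStrip.base (S := S) fun v => S.F v)
  obtain ⟨γ⟩ := DPrimeStrip.nonempty_iso 𝔡.tautStrip (FPrimeStrip.base (S.assocStrip S.HT))
  exact ⟨{ J := FlStar 𝔡.l, capsuleF := fun _ v => S.F v, globF := S.FG, globFF := S.FGlob, dash := S.dashModel,
           psiNF := fun j => 𝔡.labIsoG δ₀ (j⁻¹ • 𝔡.εLab), HT := S.HT,
           underPolyΘ := fun j v =>
             {g | ∃ f ∈ 𝔡.modelThetaBridge j v, g = (Pi.isoApp κ₀ v).inv ≫ f ≫ (Pi.isoApp γ v).hom},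
           under_isModel := ⟨Equiv.refl _, fun _ => κ₀, δ₀, γ, fun j v => by
             rw [Equiv.refl_apply, FPolyHomNF.under_eq_conj S δ₀ j⁻¹ v (Pi.isoApp κ₀ v), inv_inv],
             fun j v => rfl⟩ }⟩

/-- **Definition 5.5 (ii) is non-vacuous over every stub**: Θ-bridges exist. [claim: Mochizuki2012, status: disputed] -/
theorem nonempty_thetaBridge : Nonempty (ThetaBridge S) :=
  ⟨(nonempty_thetaNFHodgeTheater S).some.toThetaBridge⟩

variable {S}

/-- **Corollary 5.6 (iii) holds** ([IUTchI] p. 154): for an NF-bridge and a Θ-bridge over any stub `S`, the gluing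
bijections of the underlying `𝒟`-bridges number exactly `l^⋇` (Prop. 4.8 (iii)). [claim: Mochizuki2012, status: disputed] -/
theorem cor56iii_holds (B : NFBridge S) (T : ThetaBridge S) : Cor56iii B T :=
  prop48iii_holds B.under T.under

end S5Local

end BaseThetaDatum

end Literature.IUT.HodgeTheaters
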